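import Literature.Topology.FourManifolds.TrisectionsSectorOneDecomposition
import Literature.Topology.FourManifolds.TrisectionsSectorTwoFlowRule
import Literature.Topology.FourManifolds.TrisectionsSectorTwoHandles
import HarnessLib

/-!
# The handle decomposition of the second sector of the Morse-theoretic trisection

Topic `Literature/Topology/FourManifolds`; step F (part ii, second sector) of a Morse-theoretic
construction of Gay–Kirby's trisection for the fact seat
`provefact-Literature.Topology.FourManifolds.exists_isBalancedGKTrisection` (Gay–Kirby 2016,
Thm. 4 via §4, Lemma 14).  Everything in this file is **proved**; no new definitions.

For the second sector `X₂ = {0 ≤ s ≤ T}` the function `ψ₂ = 1 - C s (T - s) W R`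
(`HandleBoxes.psiTwo`) is fed into `CornerSliceAtlas.hasHandleDecomposition_of_comp_val` over
`D.atlas₂`: corner form `1 - (C w_b/2)(2uv)` along `F` (the weight is the constant `w_b` near
`F`), `= 1` on the faces, `< 1` inside, regular on the faces (the derivative along the
gradient-like field is `ξ(f)·T·W·R > 0` on `{s = 0}` and `s·(D - 1)ξ(f)·W·R < 0` on `{s = T}`,
`mlineDeriv_mul_of_eq_zero`), and at interior points the **trichotomy**
(`trichotomy`): a point of the chart zone of a `2`-handle (only critical point `c_j`,
nondegenerate of index `0`, `TrisectionsSectorTwoHandles`), of the tube saturation (no critical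
point), or of the flow-rule region (critical iff over a critical point of the Heegaard function
at the right height, nondegenerate of the same index, `TrisectionsSectorTwoFlowRule`).  Result:
`hasHandleDecomposition_S₂` — **`HasHandleDecomposition 3 ↥X₂ c` with `c i` the number of
interior critical points of `ψ₂` of index `i`, and `c i = 0` for `i ≥ 2`** (the Heegaard
function being ordered: index `≤ 1` below `b`).  With `X₂` connected,
`HasHandleDecomposition.exists_handleCount_one` (`TrisectionsHandleCounts.lean`) turns this into
`handleCount 1 k₂` ("the `2`-handles cancel `g - k` of the `S¹ × B³`'s").

## References

* D. Gay, R. Kirby, *Trisecting 4-manifolds*, Geom. Topol. 20 (2016), §4, Lemma 14. [GayKirby2016]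
* J. Milnor, *Morse theory* (1963), Thm. 3.1 and §3. [Milnor1963]
-/

open scoped Manifold ContDiff Topology
open Set Function Filter

noncomputable section

universe u

namespace Literature.Topology.FourManifolds

open Flow

/-- Local notation: `𝔼 n` is the model Euclidean space `EuclideanSpace ℝ (Fin n)`. -/
local notation "𝔼 " n:arg => EuclideanSpace ℝ (Fin n)

variable {X : Type u} [TopologicalSpace X] [T2Space X] [CompactSpace X] [ChartedSpace (𝔼 4) X]
  [IsManifold (𝓡 4) ∞ X]

/-! ### Derivative along a vector of a product with a vanishing factor -/

omit [T2Space X] [CompactSpace X] [IsManifold (𝓡 4) ∞ X] in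
/-- `v(G₁ G₂) = G₂(z) · v(G₁)` at a zero of `G₁`. [folklore] -/
theorem mlineDeriv_mul_of_eq_zero {G₁ G₂ : X → ℝ} {z : X} (h0 : G₁ z = 0)
    (h₁ : MDifferentiableAt (𝓡 4) 𝓘(ℝ, ℝ) G₁ z) (h₂ : MDifferentiableAt (𝓡 4) 𝓘(ℝ, ℝ) G₂ z) (v : TangentSpace (𝓡 4) z) :
    mlineDeriv (𝓡 4) (fun y => G₁ y * G₂ y) z v = G₂ z * mlineDeriv (𝓡 4) G₁ z v := by
  have h := (h₁.hasMFDerivAt.mul h₂.hasMFDerivAt).mfderiv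
  rw [mlineDeriv_def, show (fun y => G₁ y * G₂ y) = G₁ * G₂ from rfl, h, mlineDeriv_def]
  simp only [h0, zero_smul, zero_add]
  rfl

namespace HandleBoxes

variable {f : X → ℝ} {ξ : Π x : X, TangentSpace (𝓡 4) x} {a η : ℝ} {ι : Type} [Fintype ι]
  (H : HandleBoxes f ξ a η ι)
  {hξ : ContMDiff (𝓡 4) (𝓡 4).tangent ∞ fun x => (⟨x, ξ x⟩ : TangentBundle (𝓡 4) X)}
  {h : IsRegularLevel (𝓡 4) f a} {φ : RegularLevel h → ℝ} {h₂ TP χlo χhi w ρ R₀ : ℝ → ℝ}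
  {Spl Sbot Smin Psw c₀ ε κ aR : ℝ}

/-- **`ξ(T_bot) = D_bot · ξ(f)` on the band.** [cite: GayKirby2016, §4, Lemma 14] -/
theorem mlineDeriv_topHeightBot_eq (hgl : IsGradientLike (𝓡 4) f ξ) (hfM : IsMorse (𝓡 4) f)
    (hT : ContMDiff (𝓡 4) 𝓘(ℝ, ℝ) ∞ (H.topHeight hξ h φ h₂ TP χlo χhi Spl Smin Psw))
    (hχlo : ContDiff ℝ ∞ χlo) (hχhi : ContDiff ℝ ∞ χhi)
    {P₁ v₁ : ℝ} (hPsw0 : 0 < Psw) (hPsw : 2 * Psw ≤ η ^ 2) (hP₁ : 2 * P₁ < Psw)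
    (hTP₂ : ∀ P, 2 * P₁ ≤ P → TP P = Spl) (hh₂v : ∀ t ≤ v₁, h₂ t = Spl)
    (hφv : ∀ j (y : RegularLevel h), y.1 ∈ (H.box j).chart.source → H.P j y.1 < 2 * Psw → φ y ≤ v₁)
    {z : X} (hf₁ : a - η < f z) (hf₂ : f z < a + 2 * η) :
    mlineDeriv (𝓡 4) (H.topHeightBot hξ h φ h₂ TP χlo χhi Spl Sbot Smin Psw) z (ξ z) =
      H.topCoeffBot hξ h φ h₂ TP χlo χhi Spl Sbot Smin Psw z * mlineDeriv (𝓡 4) f z (ξ z) := by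
  have hfd : MDifferentiableAt (𝓡 4) 𝓘(ℝ, ℝ) f z := hfM.contMDiff.mdifferentiableAt (by simp)
  have hTd : MDifferentiableAt (𝓡 4) 𝓘(ℝ, ℝ) (H.topHeight hξ h φ h₂ TP χlo χhi Spl Smin Psw) z := (hT z).mdifferentiableAt (by simp)
  -- the correction term `(1 - χlo(f - a))ΔS` as `φ₀ ∘ f`
  set φ₀ : ℝ → ℝ := fun q => (1 - χlo (q - a)) * (Sbot - Spl) with hφ₀
  have hφ₀d : HasDerivAt φ₀ (-(deriv χlo (f z - a)) * (Sbot - Spl)) (f z) := by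
    have h1 : HasDerivAt (fun q => χlo (q - a)) (deriv χlo (f z - a)) (f z) := by
      have := ((hχlo.differentiable (by simp)) (f z - a)).hasDerivAt.comp (f z) ((hasDerivAt_id (f z)).sub_const a)
      simpa [Function.comp_def] using this
    have h2 := ((hasDerivAt_const (f z) (1 : ℝ)).sub h1).mul_const (Sbot - Spl)
    simpa [hφ₀] using h2
  have hcorr : mlineDeriv (𝓡 4) (fun y => φ₀ (f y)) z (ξ z) = -(deriv χlo (f z - a)) * (Sbot - Spl) * mlineDeriv (𝓡 4) f z (ξ z) :=
    mlineDeriv_real_comp' hφ₀d hfd (ξ z)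
  have hcd : MDifferentiableAt (𝓡 4) 𝓘(ℝ, ℝ) (fun y => φ₀ (f y)) z := (hasMFDerivAt_real_comp' hφ₀d hfd).mdifferentiableAt
  have hsum : H.topHeightBot hξ h φ h₂ TP χlo χhi Spl Sbot Smin Psw =
      (H.topHeight hξ h φ h₂ TP χlo χhi Spl Smin Psw) + fun y => φ₀ (f y) := by
    funext y; simp only [topHeightBot, Pi.add_apply, hφ₀]
  rw [mlineDeriv_def, hsum, mfderiv_add hTd hcd]
  show mlineDeriv (𝓡 4) (H.topHeight hξ h φ h₂ TP χlo χhi Spl Smin Psw) z (ξ z) + mlineDeriv (𝓡 4) (fun y => φ₀ (f y)) z (ξ z) = _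
  rw [H.mlineDeriv_topHeight_eq hgl hfM hT hχlo hχhi hPsw0 hPsw hP₁ hTP₂ hh₂v hφv hf₁ hf₂, hcorr, topCoeffBot_eq]
  ring

/-- **The trichotomy for an interior point of the second sector**: a band point `z` is in a
chart zone, or in `source_j` with `A_j ≥ a_R` and `P_j < 2P_sw`, or hits the level with
`P_j ≥ 2P_sw` and `A_j ≥ a_R` on every chart domain containing it (`0 < a_R`). [folklore] -/
theorem trichotomy (hgl : IsGradientLike (𝓡 4) f ξ) (hfM : IsMorse (𝓡 4) f) (haR : 0 < aR)
    {z : X} (hf₁ : a - η < f z) (hf₂ : f z < a + 2 * η) :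
    (∃ j, z ∈ H.zone aR j) ∨
      (∃ j, z ∈ (H.box j).chart.source ∧ aR ≤ H.A j z ∧ H.P j z < 2 * Psw) ∨
      (Hits (flowθ hξ) f a z ∧ ∀ j, z ∈ (H.box j).chart.source → 2 * Psw ≤ H.P j z ∧ aR ≤ H.A j z) := by
  by_cases h1 : ∃ j, z ∈ H.zone aR j
  · exact Or.inl h1
  · push Not at h1
    have hA : ∀ j, z ∈ (H.box j).chart.source → aR ≤ H.A j z := fun j hj => by
      by_contra hlt; push Not at hlt; exact h1 j ⟨hj, hlt⟩
    by_cases h2 : ∃ j, z ∈ (H.box j).chart.source ∧ H.P j z < 2 * Psw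
    · obtain ⟨j, hj, hP⟩ := h2
      exact Or.inr (Or.inl ⟨j, hj, hA j hj, hP⟩)
    · push Not at h2
      refine Or.inr (Or.inr ⟨?_, fun j hj => ⟨h2 j hj, hA j hj⟩⟩)
      rcases H.hits_or_exists_A_eq_zero (hξ := hξ) hgl hfM hf₁ hf₂ with hh | ⟨j, hbox, hA0⟩
      · exact hh
      · exfalso; exact h1 j ⟨hbox.1, by rw [hA0]; exact haR⟩

end HandleBoxes

/-! ### The handle decomposition of the second sector -/

variable (B : BiCollar X) {η : ℝ} {ι : Type} [Fintype ι] {ζ : Π x : X, TangentSpace (𝓡 4) x}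
  (H : HandleBoxes B.f ζ B.a η ι) {hζ : ContMDiff (𝓡 4) (𝓡 4).tangent ∞ fun x => (⟨x, ζ x⟩ : TangentBundle (𝓡 4) X)}
  {h₂ TP χlo χhi w ρ R₀ : ℝ → ℝ} {Spl Sbot Smin Psw c₀ ε κ aR C : ℝ} (D : B.TwoFnData)

namespace BiCollar.TwoFnData

set_option maxHeartbeats 800000 in
/-- **The handle decomposition of the second sector** (`c i` = the number of interior critical
points of `ψ₂` of index `i`, and these sets are empty for `i ≥ 2`).  The hypotheses are those of
the band analyses of `TrisectionsSectorTwoFunction/FlowRule/Handles`, the numerical design of the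
profiles (sign conditions in the three regimes), the corner data (`w ∘ φ̄` constant on the
bi-collar box, whose points are flow-rule points; the top height of `D` is `T_bot ≤ S_bot`), and
the ordering of the Heegaard function (index `≤ 1` below `b`).
[cite: GayKirby2016, §4, Lemma 14] [cite: Milnor1963, Thm. 3.1 and §3] -/
theorem hasHandleDecomposition_S₂ (hgl : IsGradientLike (𝓡 4) B.f ζ) (hfM : IsMorse (𝓡 4) B.f)
    (hφM : IsMorse (𝓡 3) B.g)
    (hDT : D.T = H.topHeightBot hζ B.hf B.g h₂ TP χlo χhi Spl Sbot Smin Psw)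
    (hT : ContMDiff (𝓡 4) 𝓘(ℝ, ℝ) ∞ (H.topHeight hζ B.hf B.g h₂ TP χlo χhi Spl Smin Psw))
    (hχlo : ContDiff ℝ ∞ χlo) (hχhi : ContDiff ℝ ∞ χhi) (hh₂ : ContDiff ℝ ∞ h₂) (hTPs : ContDiff ℝ ∞ TP)
    (hw : ContDiff ℝ ∞ w) (hρs : ContDiff ℝ ∞ ρ) (hR₀s : ContDiff ℝ ∞ R₀)
    {P₁ v₁ δ' aR' β₀ wb vW : ℝ} (hPsw0 : 0 < Psw) (hPsw : 2 * Psw ≤ η ^ 2) (hP₁ : 2 * P₁ < Psw)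
    (hTP₂ : ∀ P, 2 * P₁ ≤ P → TP P = Spl) (hh₂v : ∀ t ≤ v₁, h₂ t = Spl)
    (hφv : ∀ j (y : RegularLevel B.hf), y.1 ∈ (H.box j).chart.source → H.P j y.1 < 2 * Psw → B.g y ≤ v₁)
    (hε : 0 < ε) (hκ : 0 < κ) (hC : 0 < C) (hcc : 0 < c₀) (hβ₀ : 0 < β₀)
    (haR : 0 < aR) (haR2 : 2 * aR ≤ η) (haRβ' : η - β₀ < 2 * aR)
    (hρ : ∀ A, aR / 2 ≤ A → A ≤ 2 * aR → ρ A = A⁻¹)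
    (hκδ : κ / η * (2 * Psw) < 2 * δ') (hκδ' : κ / η * (2 * aR) * (2 * η) < 2 * δ')
    (hφ : ∀ j (y : RegularLevel B.hf), y.1 ∈ (H.box j).chart.source →
      TubeModel.tube ε κ η ((H.box j).coord y.1) < 1 + 2 * δ' →
      B.g y = c₀ * TubeModel.tube ε κ η ((H.box j).coord y.1))
    (haR' : aR' < aR) (haR'0 : 0 < aR') (hR₀ : ∀ A, aR' ≤ A → R₀ A = 1) (hR₀pos : ∀ A, 0 < R₀ A)
    (hTP₁ : ∀ P, P ≤ P₁ → TP P = η + β₀ - P / β₀) (haRP : aR * (Sbot + η / 4 - η + aR) ≤ P₁)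
    (hTP' : ∀ P, deriv TP P ≤ 0)
    (hplateau : ∀ s, -η / 2 < s → s < Sbot + η / 4 → χlo s = 1 ∧ χhi s = 1)
    (hTle : ∀ z, D.T z ≤ Sbot) (hSbot : Sbot + η / 4 < 2 * η)
    (hD : ∀ z, B.a - η < B.f z → B.f z < B.a + 2 * η →
      H.topCoeffBot hζ B.hf B.g h₂ TP χlo χhi Spl Sbot Smin Psw z ≤ 0)
    (hwpos : ∀ t, 0 < w t) (hw' : ∀ t, deriv w t ≤ 0) (hw'neg : ∀ t, t ≤ vW → deriv w t < 0)
    (hvW : c₀ * (1 + κ / η * (2 * Psw)) ≤ vW)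
    (hh₂' : ∀ t, deriv h₂ t ≤ 0) (hflow : ∀ t, t < B.b → deriv h₂ t < 0 ∨ deriv w t < 0)
    (hh₂b : ∀ t, 0 < h₂ t → t < B.b)
    (hφord : ∀ y : RegularLevel B.hf, IsMCriticalPt (𝓡 3) B.g y → B.g y < B.b → morseIndex (𝓡 3) B.g y ≤ 1)
    (hwb : ∀ x ∈ B.box D.εw, w (flowLift hζ B.hf B.g x) = wb)
    (hbox_fr : ∀ x ∈ B.box D.εw, ∀ j, x ∈ (H.box j).chart.source → aR < H.A j x)
    (hzone_design : ∀ j z, z ∈ H.zone aR j → 0 < B.f z - B.a → B.f z - B.a < D.T z →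
      fderiv ℝ (ChartZone.zoneFn (fun x => x) w ρ R₀ c₀ ε η β₀ κ) (RadialThickening.toModel ((H.box j).coord z))
          PlanarThickening.ez ≠ 0 ∧
        0 ≤ ρ (TubeModel.nsq (RadialThickening.proj ((H.box j).coord z))) ∧
        deriv ρ (TubeModel.nsq (RadialThickening.proj ((H.box j).coord z))) ≤ 0 ∧
        ChartZone.DesignIneq (fun a' => (η - a') * (β₀ + a') * R₀ a') w ρ c₀ ε
          (TubeModel.nsq (RadialThickening.proj ((H.box j).coord z)))
          (c₀ * ChartZone.gmod ε ρ (RadialThickening.proj ((H.box j).coord z))))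
    (hcpt_design : fderiv ℝ (ChartZone.zoneFn (fun x => x) w ρ R₀ c₀ ε η β₀ κ) 0 PlanarThickening.ez < 0 ∧ 0 ≤ ρ 0 ∧
        ChartZone.DesignIneq (fun a' => (η - a') * (β₀ + a') * R₀ a') w ρ c₀ ε 0 c₀)
    (hcpt_T : ∀ j, B.f (H.cpt j) - B.a < D.T (H.cpt j)) :
    letI := D.atlas₂.chartedSpace
    HasHandleDecomposition 3 D.S₂ (fun i =>
      ((Subtype.val : D.S₂ → X) '' ((𝓡∂ 4).interior D.S₂) ∩ criticalSetOfIndex (𝓡 4)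
        (H.psiTwo hζ B.hf B.g h₂ TP χlo χhi w ρ R₀ Spl Sbot Smin Psw c₀ ε κ aR C) i).ncard) ∧
      ∀ i, 2 ≤ i → (Subtype.val : D.S₂ → X) '' ((𝓡∂ 4).interior D.S₂) ∩ criticalSetOfIndex (𝓡 4)
        (H.psiTwo hζ B.hf B.g h₂ TP χlo χhi w ρ R₀ Spl Sbot Smin Psw c₀ ε κ aR C) i = ∅ := by
  letI := D.atlas₂.chartedSpace
  have hη := H.eta_pos
  have hφs : ContMDiff (𝓡 3) 𝓘(ℝ, ℝ) ∞ B.g := hφM.contMDiff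
  have hTbc : ContMDiff (𝓡 4) 𝓘(ℝ, ℝ) ∞ (H.topHeightBot hζ B.hf B.g h₂ TP χlo χhi Spl Sbot Smin Psw) :=
    H.contMDiff_topHeightBot hfM hχlo hT
  have hcontf : Continuous B.f := hfM.contMDiff.continuous
  have haR'η : aR' ≤ η := by linarith
  -- band and plateau for points of the sector
  have hband : ∀ z ∈ D.S₂, B.a - η < B.f z ∧ B.f z < B.a + 2 * η := by
    intro z hz; have := hTle z; have := hz.1; have := hz.2; exact ⟨by linarith, by linarith⟩
  have hplat : ∀ z ∈ D.S₂, ∀ᶠ s in 𝓝 (B.f z - B.a), χlo s = 1 ∧ χhi s = 1 := by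
    intro z hz
    have h1 : Ioo (-η / 2) (Sbot + η / 4) ∈ 𝓝 (B.f z - B.a) :=
      Ioo_mem_nhds (by have := hz.1; linarith) (by have := hz.2; have := hTle z; linarith)
    exact Filter.mem_of_superset h1 fun s hs => hplateau s hs.1 hs.2
  have hplat_pt : ∀ z ∈ D.S₂, χlo (B.f z - B.a) = 1 ∧ χhi (B.f z - B.a) = 1 := fun z hz => (hplat z hz).self_of_nhds
  -- smoothness of `W`, `R`, `Ψ₂`, `ψ₂`
  have hWs : ∀ z ∈ D.S₂, ContMDiffAt (𝓡 4) 𝓘(ℝ, ℝ) ∞ (H.weight hζ B.hf B.g w ρ c₀ ε κ aR) z :=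
    fun z hz => H.contMDiffAt_weight hgl hfM hφs hw hρs hε.le hκ.le haR haR2 hρ hκδ' hφ (hband z hz).1 (hband z hz).2
  have hRs : ∀ z ∈ D.S₂, ContMDiffAt (𝓡 4) 𝓘(ℝ, ℝ) ∞ (H.radial R₀) z :=
    fun z hz => H.contMDiffAt_radial hfM hR₀s haR'η hR₀ (hband z hz).2
  have hΨs : ∀ z ∈ D.S₂, ContMDiffAt (𝓡 4) 𝓘(ℝ, ℝ) ∞
      (H.psiTwoRaw hζ B.hf B.g h₂ TP χlo χhi w ρ R₀ Spl Sbot Smin Psw c₀ ε κ aR) z :=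
    fun z hz => H.contMDiffAt_psiTwoRaw hfM hTbc (hWs z hz) (hRs z hz)
  have hψs : ∀ z ∈ D.S₂, ContMDiffAt (𝓡 4) 𝓘(ℝ, ℝ) ∞
      (H.psiTwo hζ B.hf B.g h₂ TP χlo χhi w ρ R₀ Spl Sbot Smin Psw c₀ ε κ aR C) z :=
    fun z hz => H.contMDiffAt_psiTwo (hΨs z hz)
  -- positivity of `W` and `R`
  have hWpos : ∀ z, 0 < H.weight hζ B.hf B.g w ρ c₀ ε κ aR z := by
    intro z
    by_cases h1 : ∃ j, z ∈ H.zone aR j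
    · obtain ⟨j, hj⟩ := h1; rw [H.weight_of_mem_zone hj]; exact hwpos _
    · push Not at h1; rw [H.weight_of_forall_not_mem h1]; exact hwpos _
  have hRpos : ∀ z, 0 < H.radial R₀ z := by
    intro z
    by_cases h1 : ∃ j, z ∈ (H.box j).chart.source
    · obtain ⟨j, hj⟩ := h1; rw [H.radial_of_mem_source hj]; exact hR₀pos _
    · push Not at h1; rw [H.radial_of_forall_not_mem h1]; exact one_pos
  -- values of `Ψ₂` and `ψ₂`
  have hΨ_apply : ∀ z, H.psiTwoRaw hζ B.hf B.g h₂ TP χlo χhi w ρ R₀ Spl Sbot Smin Psw c₀ ε κ aR z =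
      (B.f z - B.a) * (D.T z - (B.f z - B.a)) * H.weight hζ B.hf B.g w ρ c₀ ε κ aR z * H.radial R₀ z := by
    intro z; simp only [HandleBoxes.psiTwoRaw, hDT]
  have hψ_apply : ∀ z, H.psiTwo hζ B.hf B.g h₂ TP χlo χhi w ρ R₀ Spl Sbot Smin Psw c₀ ε κ aR C z =
      1 - C * ((B.f z - B.a) * (D.T z - (B.f z - B.a)) * H.weight hζ B.hf B.g w ρ c₀ ε κ aR z * H.radial R₀ z) := by
    intro z; simp only [HandleBoxes.psiTwo, hΨ_apply]
  -- `W = w(φ̄)` and `R = 1` on the bi-collar box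
  have hW_box : ∀ x ∈ B.box D.εw, x ∈ D.S₂ → H.weight hζ B.hf B.g w ρ c₀ ε κ aR x = wb := by
    intro x hx hxS
    have hev := H.weight_eventuallyEq_w_flowLift (hξ := hζ) (h := B.hf) (w := w) (c₀ := c₀) hgl hfM hε.le hκ.le
      haR2 hρ hκδ' hφ (hband x hxS).2 (fun j hj => by linarith [hbox_fr x hx j hj])
    rw [show H.weight hζ B.hf B.g w ρ c₀ ε κ aR x = w (flowLift hζ B.hf B.g x) from hev.self_of_nhds]
    exact hwb x hx
  have hR_box : ∀ x ∈ B.box D.εw, H.radial R₀ x = 1 := by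
    intro x hx
    exact H.radial_eq_one_of_le hR₀ fun j hj => by linarith [hbox_fr x hx j hj]
  -- critical points of `f` in the sector are the `cpt j`
  have hcritf : ∀ z ∈ D.S₂, IsMCriticalPt (𝓡 4) B.f z → ∃ j, z = H.cpt j := by
    intro z hz hc
    exact H.crit_val z hc (hband z hz).1.le (hband z hz).2
  -- `ξ(ψ₂) = -C ξ(Ψ₂)`
  have hψ_fun : H.psiTwo hζ B.hf B.g h₂ TP χlo χhi w ρ R₀ Spl Sbot Smin Psw c₀ ε κ aR C =
      fun y => (fun q : ℝ => 1 - C * q) (H.psiTwoRaw hζ B.hf B.g h₂ TP χlo χhi w ρ R₀ Spl Sbot Smin Psw c₀ ε κ aR y) := rfl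
  have hline_ψ : ∀ z ∈ D.S₂, mlineDeriv (𝓡 4) (H.psiTwo hζ B.hf B.g h₂ TP χlo χhi w ρ R₀ Spl Sbot Smin Psw c₀ ε κ aR C)
      z (ζ z) = -C * mlineDeriv (𝓡 4) (H.psiTwoRaw hζ B.hf B.g h₂ TP χlo χhi w ρ R₀ Spl Sbot Smin Psw c₀ ε κ aR)
        z (ζ z) := by
    intro z hz
    have hφd : HasDerivAt (fun q : ℝ => 1 - C * q) (-C)
        (H.psiTwoRaw hζ B.hf B.g h₂ TP χlo χhi w ρ R₀ Spl Sbot Smin Psw c₀ ε κ aR z) := by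
      simpa using ((hasDerivAt_id _).const_mul C).const_sub 1
    rw [hψ_fun]
    exact mlineDeriv_real_comp' hφd ((hΨs z hz).mdifferentiableAt (by simp)) _
  have hline_crit : ∀ {G : X → ℝ} {z : X}, IsMCriticalPt (𝓡 4) G z → mlineDeriv (𝓡 4) G z (ζ z) = 0 := by
    intro G z hc
    rw [mlineDeriv_def]
    have hc' : mfderiv (𝓡 4) 𝓘(ℝ, ℝ) G z = 0 := hc
    rw [hc']; rfl
  -- `ξ(f - a) = ξ(f)`
  have hline_s : ∀ z, mlineDeriv (𝓡 4) (fun y => B.f y - B.a) z (ζ z) = mlineDeriv (𝓡 4) B.f z (ζ z) := by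
    intro z
    have hfd : MDifferentiableAt (𝓡 4) 𝓘(ℝ, ℝ) B.f z := hfM.contMDiff.mdifferentiableAt (by simp)
    have hd : HasDerivAt (fun q : ℝ => q - B.a) 1 (B.f z) := by simpa using (hasDerivAt_id (B.f z)).sub_const B.a
    have := mlineDeriv_real_comp' hd hfd (ζ z)
    simpa using this
  have hsd : ∀ z, MDifferentiableAt (𝓡 4) 𝓘(ℝ, ℝ) (fun y => B.f y - B.a) z := fun z =>
    (hfM.contMDiff.mdifferentiableAt (by simp)).sub mdifferentiableAt_const
  have hTd : ∀ z, MDifferentiableAt (𝓡 4) 𝓘(ℝ, ℝ) D.T z := fun z => by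
    rw [hDT]; exact (hTbc z).mdifferentiableAt (by simp)
  ------------------------------------------------------------------
  -- the interior analysis: trichotomy
  ------------------------------------------------------------------
  have hinterior : ∀ z ∈ D.S₂, 0 < B.f z - B.a → B.f z - B.a < D.T z →
      IsMCriticalPt (𝓡 4) (H.psiTwo hζ B.hf B.g h₂ TP χlo χhi w ρ R₀ Spl Sbot Smin Psw c₀ ε κ aR C) z →
      (mhessian (𝓡 4) (H.psiTwo hζ B.hf B.g h₂ TP χlo χhi w ρ R₀ Spl Sbot Smin Psw c₀ ε κ aR C) z).Nondegenerate ∧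
        morseIndex (𝓡 4) (H.psiTwo hζ B.hf B.g h₂ TP χlo χhi w ρ R₀ Spl Sbot Smin Psw c₀ ε κ aR C) z ≤ 1 := by
    intro z hz hs hsT hcrit
    obtain ⟨hf₁, hf₂⟩ := hband z hz
    have hDTz : D.T z = H.topHeightBot hζ B.hf B.g h₂ TP χlo χhi Spl Sbot Smin Psw z := by rw [hDT]
    rcases H.trichotomy (hξ := hζ) (Psw := Psw) hgl hfM haR hf₁ hf₂ with ⟨j, hzone⟩ | ⟨j, hzj, hA, hP⟩ | ⟨hhit, hreg⟩
    · -- chart zone: the critical point is `cpt j`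
      have hev := H.psiTwoRaw_eventuallyEq_zoneFn' (hξ := hζ) (h := B.hf) (φ := B.g) (h₂ := h₂) (TP := TP)
        (χlo := χlo) (χhi := χhi) (w := w) (ρ := ρ) (R₀ := R₀) (Spl := Spl) (Sbot := Sbot) (Smin := Smin) (Psw := Psw)
        (c₀ := c₀) (ε := ε) (κ := κ) hfM hβ₀.ne' hTP₁ haRP (by linarith) haR.le hzone
        (by linarith [hTle z] : B.f z - B.a < Sbot + η / 4) (hplat z hz)
      obtain ⟨hb, hρ0, hρ', hDes⟩ := hzone_design j z hzone hs hsT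
      have hA := hzone.2
      have hA0 := H.A_nonneg j z
      have hApos' : 0 < (η - TubeModel.nsq (RadialThickening.proj ((H.box j).coord z))) *
          (β₀ + TubeModel.nsq (RadialThickening.proj ((H.box j).coord z))) *
          R₀ (TubeModel.nsq (RadialThickening.proj ((H.box j).coord z))) := by
        rw [← HandleBoxes.A_eq_nsq]
        exact mul_pos (mul_pos (by linarith) (by linarith)) (hR₀pos _)
      have hzc : z = H.cpt j := H.eq_cpt_of_isMCriticalPt_psiTwo_zone (hw.of_le (by norm_cast)) (hρs.of_le (by norm_cast))
        (hR₀s.of_le (by norm_cast)) hβ₀.ne' hC.ne' hzone.1 hev hb hApos' hρ0 hρ' (hw' _) (mul_pos hcc hε).le hDes hcrit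
      subst hzc
      have hev0 := H.psiTwoRaw_eventuallyEq_zoneFn' (hξ := hζ) (h := B.hf) (φ := B.g) (h₂ := h₂) (TP := TP)
        (χlo := χlo) (χhi := χhi) (w := w) (ρ := ρ) (R₀ := R₀) (Spl := Spl) (Sbot := Sbot) (Smin := Smin) (Psw := Psw)
        (c₀ := c₀) (ε := ε) (κ := κ) hfM hβ₀.ne' hTP₁ haRP (by linarith) haR.le hzone
        (by linarith [hTle (H.cpt j)] : B.f (H.cpt j) - B.a < Sbot + η / 4) (hplat _ hz)
      obtain ⟨-, hnd, hidx⟩ := H.morseData_psiTwo_cpt (hw.of_le (by norm_cast)) (hρs.of_le (by norm_cast))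
        (hR₀s.of_le (by norm_cast)) hβ₀.ne' hC hev0 hcpt_design.1 (mul_pos (mul_pos hη hβ₀) (hR₀pos 0)) hcpt_design.2.1
        (hw' _) (mul_pos hcc hε).le hcpt_design.2.2
      exact ⟨hnd, by rw [hidx]; norm_num⟩
    · -- tube saturation: no critical point
      exfalso
      have hAlo : aR / 2 < H.A j z := by linarith
      have hev := H.psiTwoRaw_eventuallyEq_satFn' (hξ := hζ) (w := w) (Sbot := Sbot) (Smin := Smin) hgl hfM hε.le hκ.le
        hPsw hP₁ hTP₂ hh₂v hφv haR hρ hφ hκδ hR₀ hzj hAlo (by linarith [hA] : aR' < H.A j z) hP hf₁ hf₂ (hplat z hz)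
      have hP₁0 : 0 ≤ P₁ := by
        have h1 := hcpt_T j
        have h2 := hTle (H.cpt j)
        rw [H.apply_cpt] at h1
        have h3 : 0 ≤ aR * (Sbot + η / 4 - η + aR) := mul_nonneg haR.le (by linarith)
        linarith [haRP]
      have hApos : 0 < H.A j z := by linarith
      have hTz : D.T z = TP (H.P j z) := by
        rw [hDTz]; exact H.topHeightBot_eq_TP hgl hfM hPsw hP₁ hTP₂ hh₂v hφv hzj hP hf₁ hf₂ (hplat_pt z hz).1 (hplat_pt z hz).2
      have htube : c₀ * TubeModel.tube ε κ η ((H.box j).coord z) ≤ vW := by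
        have h1 := H.tube_coord_le hε.le κ j z
        have h2 : κ / η * H.P j z ≤ κ / η * (2 * Psw) := mul_le_mul_of_nonneg_left hP.le (div_nonneg hκ.le hη.le)
        nlinarith
      refine H.not_isMCriticalPt_psiTwo_tube (hTPs.differentiable (by simp)) (hw.differentiable (by simp)) hzj hev hC.ne'
        hApos hs (by rw [← hTz]; linarith) (hwpos _) (hw'neg _ htube) (hTP' _) hcc hε (div_pos hκ hη) ?_ hcrit
      intro hB
      have hfz := H.apply_eq hzj
      rw [hTP₁ 0 hP₁0, zero_div, sub_zero]
      rw [hB, add_zero] at hfz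
      linarith
    · -- flow rule
      have hreg' : ∀ j, z ∈ (H.box j).chart.source → 2 * P₁ < H.P j z ∧ aR / 2 < H.A j z ∧ aR' < H.A j z := by
        intro j hj; obtain ⟨hP, hA⟩ := hreg j hj; exact ⟨by linarith, by linarith, by linarith⟩
      have hraw := H.psiTwoRaw_eventuallyEq_flowRule (w := w) (Sbot := Sbot) (Smin := Smin) hgl hfM hε.le hκ.le hPsw hTP₂ hh₂v hφv
        hPsw0 haR2 hρ hκδ' hφ haR'η hR₀ hf₁ hf₂ hhit (hplat z hz) hreg'
      -- `T z = h₂(φ̄ z)`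
      have hTz : D.T z = h₂ (flowLift hζ B.hf B.g z) := by
        rw [hDTz]
        exact (H.topHeightBot_eventuallyEq_h₂_flowLift (Sbot := Sbot) (Smin := Smin) hgl hfM hPsw0 hPsw hTP₂ hh₂v hφv hf₁ hf₂ hhit
          (hplat z hz) fun j hj => (hreg' j hj).1).self_of_nhds
      have hlt_b : flowLift hζ B.hf B.g z < B.b := hh₂b _ (by rw [← hTz]; linarith)
      have hwz : 0 < w (flowLift hζ B.hf B.g z) := hwpos _
      have h1 : deriv h₂ (flowLift hζ B.hf B.g z) * w (flowLift hζ B.hf B.g z) +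
          (h₂ (flowLift hζ B.hf B.g z) - (B.f z - B.a)) * deriv w (flowLift hζ B.hf B.g z) < 0 := by
        have hpos : 0 < h₂ (flowLift hζ B.hf B.g z) - (B.f z - B.a) := by rw [← hTz]; linarith
        rcases hflow _ hlt_b with hlt | hlt
        · have := mul_nonpos_of_nonneg_of_nonpos hpos.le (hw' (flowLift hζ B.hf B.g z))
          nlinarith [hwz]
        · have := mul_nonpos_of_nonpos_of_nonneg (hh₂' (flowLift hζ B.hf B.g z)) hwz.le
          nlinarith
      obtain ⟨hq, hcφ⟩ := (H.isMCriticalPt_psiTwo_flowRule_iff hgl hfM hφs hh₂ hw hhit hraw hC.ne' hs.ne' hwz.ne' h1.ne).1 hcrit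
      obtain ⟨hnd, hidx⟩ := H.morseData_psiTwo_flowRule hgl hfM hφM hh₂ hw hhit hraw hC hs hwz h1 hq hcφ
      refine ⟨hnd, ?_⟩
      rw [hidx]
      refine hφord _ hcφ ?_
      rw [← flowLift_of_hits B.g hhit]; exact hlt_b
  ------------------------------------------------------------------
  -- the corner-slice atlas argument
  ------------------------------------------------------------------
  have hmain := D.atlas₂.hasHandleDecomposition_of_comp_val
    (F := H.psiTwo hζ B.hf B.g h₂ TP χlo χhi w ρ R₀ Spl Sbot Smin Psw c₀ ε κ aR C)
    (c := fun i => ((Subtype.val : D.S₂ → X) '' ((𝓡∂ 4).interior D.S₂) ∩ criticalSetOfIndex (𝓡 4)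
        (H.psiTwo hζ B.hf B.g h₂ TP χlo χhi w ρ R₀ Spl Sbot Smin Psw c₀ ε κ aR C) i).ncard)
    (fun q hq _ => hψs q hq) (fun p hp => ?_) (fun p hb => ?_) (fun p hb hpK => ?_) (fun p hi => ?_) (fun p hi hc => ?_)
    (fun i => rfl)
  · refine ⟨hmain, fun i hi => ?_⟩
    ext x
    simp only [mem_inter_iff, mem_image, mem_criticalSetOfIndex, mem_empty_iff_false, iff_false, not_and]
    rintro ⟨p, hpi, rfl⟩ hc hidx
    obtain ⟨h1, h2⟩ := (D.isInteriorPoint₂_iff p).1 hpi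
    have := (hinterior p.1 p.2 h1 h2 hc).2
    omega
  · -- corner form
    have hwb0 : 0 < wb := by
      obtain ⟨z⟩ := B.nonempty_F
      have hx := B.mem_box_of_mem_surface D.εw_pos (show RegularLevel.incl B.hf (RegularLevel.incl B.hg z) ∈ B.surface from ⟨z, rfl⟩)
      rw [← hwb _ hx]; exact hwpos _
    refine ⟨cornerOuter (C * wb), (contDiff_cornerOuter _).contDiffAt, fderiv_cornerOuter_ne_zero (mul_pos hC hwb0).ne' _,
      fun q hq hqS => ?_⟩
    have hqb : q ∈ B.box D.εw := hq.1
    rw [cornerOuter_cornerFold, (D.atlas₂.cornerDatum p hp).apply_zero q hq, (D.atlas₂.cornerDatum p hp).apply_one q hq,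
      uFun_W₂, vFun_W₂, hψ_apply, D.T_box q hqb, hW_box q hqb hqS, hR_box q hqb, BiCollar.sFun]
    ring
  · -- `= 1` on the boundary
    rcases (D.isBoundaryPoint₂_iff p).1 hb with h0 | h0
    · rw [hψ_apply, h0]; ring
    · rw [hψ_apply, h0]; ring
  · -- regular on the boundary off `F`
    have hp := p.2
    obtain ⟨hf₁, hf₂⟩ := hband p.1 hp
    intro hc
    have h0 := hline_crit hc
    rw [hline_ψ p.1 hp] at h0
    have hΨ0 : mlineDeriv (𝓡 4) (H.psiTwoRaw hζ B.hf B.g h₂ TP χlo χhi w ρ R₀ Spl Sbot Smin Psw c₀ ε κ aR) p.1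
        (ζ p.1) = 0 := by
      rcases mul_eq_zero.1 h0 with h' | h'
      · exact absurd (neg_eq_zero.1 h') hC.ne'
      · exact h'
    have hWd : MDifferentiableAt (𝓡 4) 𝓘(ℝ, ℝ) (H.weight hζ B.hf B.g w ρ c₀ ε κ aR) p.1 :=
      (hWs p.1 hp).mdifferentiableAt (by simp)
    have hRd : MDifferentiableAt (𝓡 4) 𝓘(ℝ, ℝ) (H.radial R₀) p.1 := (hRs p.1 hp).mdifferentiableAt (by simp)
    rcases (D.isBoundaryPoint₂_iff p).1 hb with hs0 | hsT
    · -- the face `s = 0`: `ξ(Ψ₂) = ξ(f) · T W R > 0`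
      have hTs : 0 < D.T p.1 - (B.f p.1 - B.a) := D.T_sub_pos_of_s_eq_zero hp hpK hs0
      have hprod : H.psiTwoRaw hζ B.hf B.g h₂ TP χlo χhi w ρ R₀ Spl Sbot Smin Psw c₀ ε κ aR = fun y =>
          (B.f y - B.a) * ((D.T y - (B.f y - B.a)) * H.weight hζ B.hf B.g w ρ c₀ ε κ aR y * H.radial R₀ y) := by
        funext y; rw [hΨ_apply]; ring
      have hG₂d : MDifferentiableAt (𝓡 4) 𝓘(ℝ, ℝ)
          (fun y => (D.T y - (B.f y - B.a)) * H.weight hζ B.hf B.g w ρ c₀ ε κ aR y * H.radial R₀ y) p.1 :=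
        (((hTd _).sub (hsd _)).mul hWd).mul hRd
      rw [hprod, mlineDeriv_mul_of_eq_zero (G₁ := fun y => B.f y - B.a) (z := p.1) hs0 (hsd _) hG₂d, hline_s] at hΨ0
      have hreg : ¬ IsMCriticalPt (𝓡 4) B.f p.1 := B.hf.not_isMCriticalPt (by linarith)
      have hξf := hgl.mlineDeriv_pos p.1 hreg
      have hG₂pos : 0 < (D.T p.1 - (B.f p.1 - B.a)) * H.weight hζ B.hf B.g w ρ c₀ ε κ aR p.1 * H.radial R₀ p.1 :=
        mul_pos (mul_pos hTs (hWpos _)) (hRpos _)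
      rcases mul_eq_zero.1 hΨ0 with h' | h'
      · exact hG₂pos.ne' h'
      · exact hξf.ne' h'
    · -- the face `s = T`: `ξ(Ψ₂) = s (D - 1) ξ(f) W R < 0`
      have hs0 : 0 < B.f p.1 - B.a := by
        rcases hp.1.eq_or_lt with h | h
        · exact absurd (D.surface_of p.1 (by linarith) (by linarith)) hpK
        · exact h
      have hprod : H.psiTwoRaw hζ B.hf B.g h₂ TP χlo χhi w ρ R₀ Spl Sbot Smin Psw c₀ ε κ aR = fun y =>
          (D.T y - (B.f y - B.a)) * ((B.f y - B.a) * H.weight hζ B.hf B.g w ρ c₀ ε κ aR y * H.radial R₀ y) := by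
        funext y; rw [hΨ_apply]; ring
      have hG₂d : MDifferentiableAt (𝓡 4) 𝓘(ℝ, ℝ)
          (fun y => (B.f y - B.a) * H.weight hζ B.hf B.g w ρ c₀ ε κ aR y * H.radial R₀ y) p.1 :=
        ((hsd _).mul hWd).mul hRd
      have hzero : D.T p.1 - (B.f p.1 - B.a) = 0 := by linarith
      rw [hprod, mlineDeriv_mul_of_eq_zero (G₁ := fun y => D.T y - (B.f y - B.a)) (z := p.1) hzero ((hTd _).sub (hsd _)) hG₂d] at hΨ0
      -- `ξ(T - s) = (D_bot - 1) ξ(f)`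
      have hline_Ts : mlineDeriv (𝓡 4) (fun y => D.T y - (B.f y - B.a)) p.1 (ζ p.1) =
          (H.topCoeffBot hζ B.hf B.g h₂ TP χlo χhi Spl Sbot Smin Psw p.1 - 1) * mlineDeriv (𝓡 4) B.f p.1 (ζ p.1) := by
        rw [mlineDeriv_def, show (fun y => D.T y - (B.f y - B.a)) = D.T - fun y => B.f y - B.a from rfl,
          (((hTd _).hasMFDerivAt).sub ((hsd _).hasMFDerivAt)).mfderiv]
        show mlineDeriv (𝓡 4) D.T p.1 (ζ p.1) - mlineDeriv (𝓡 4) (fun y => B.f y - B.a) p.1 (ζ p.1) = _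
        rw [hline_s, hDT, H.mlineDeriv_topHeightBot_eq hgl hfM hT hχlo hχhi hPsw0 hPsw hP₁ hTP₂ hh₂v hφv hf₁ hf₂]
        ring
      rw [hline_Ts] at hΨ0
      have hreg : ¬ IsMCriticalPt (𝓡 4) B.f p.1 := by
        intro hcf
        obtain ⟨j, hj⟩ := hcritf p.1 hp hcf
        have := hcpt_T j
        rw [← hj] at this
        linarith
      have hξf := hgl.mlineDeriv_pos p.1 hreg
      have hDle := hD p.1 hf₁ hf₂
      have hG₂pos : 0 < (B.f p.1 - B.a) * H.weight hζ B.hf B.g w ρ c₀ ε κ aR p.1 * H.radial R₀ p.1 :=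
        mul_pos (mul_pos hs0 (hWpos _)) (hRpos _)
      have hneg : (H.topCoeffBot hζ B.hf B.g h₂ TP χlo χhi Spl Sbot Smin Psw p.1 - 1) *
          mlineDeriv (𝓡 4) B.f p.1 (ζ p.1) < 0 := mul_neg_of_neg_of_pos (by linarith) hξf
      rcases mul_eq_zero.1 hΨ0 with h' | h'
      · exact hG₂pos.ne' h'
      · exact hneg.ne h'
  · -- `< 1` inside
    obtain ⟨h1, h2⟩ := (D.isInteriorPoint₂_iff p).1 hi
    rw [hψ_apply]
    have := mul_pos (mul_pos (mul_pos h1 (by linarith : 0 < D.T p.1 - (B.f p.1 - B.a))) (hWpos p.1)) (hRpos p.1)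
    nlinarith
  · -- nondegenerate at interior critical points
    obtain ⟨h1, h2⟩ := (D.isInteriorPoint₂_iff p).1 hi
    exact (hinterior p.1 p.2 h1 h2 hc).1

end BiCollar.TwoFnData

end Literature.Topology.FourManifolds

end
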